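/-
Origin: expansion seat `planner-pub-hodgecm-qw8-g11-0`, handover #12 SPLIT PART 1/2 of tree `HodgeCM/Model/Toy/LefPartialConjGalois.lean` 467526c6 (659 l. > 400-line cap) = NEW module `HodgeCM.Model.Toy.LefGalClosure` md5 ac345c5839f5a551293e6b65b2a705a0 (388 l.): verbatim section-boundary slice + docstrings; imports: NO rewrite (tree imports only: Mathlib, HodgeCM.Model.Toy.LefPartialConj); check-wip LANDABLE rc 0 / 0 warnings / 0 proof-hole; lean -DautoImplicit=fa (`HOME/pub-hodgecm-qw8-g11/lean/Qw8g11/LefGalClosure.lean`, md5 ac345c58, 388 lines);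
landed by the packager successor (mc-unitary-1-g3, gen-8 kit) in gate run 32 as `HodgeCM/Model/Toy/LefGalClosure.lean` (verbatim).
-/
-- HANDOVER (planner-pub-hodgecm-qw8-g11-0, unit pub-hodgecm-qw8-g11): SPLIT PART 1/2 of the installed
-- `HodgeCM.Model.Toy.LefPartialConjGalois` (md5 467526c6, 659 l.; 400-line cap, lean/CONVENTIONS.md) = its §§1–5 (ll. 69–399)
-- verbatim + docstrings; WIP module `Qw8g11.LefGalClosure`, intended final module `HodgeCM.Model.Toy.LefGalClosure` (NEW file; NO import rewrite).
/-
Copyright (c) 2026. All rights reserved.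
Released under Apache 2.0 license as described in the file LICENSE.
-/
import Mathlib
import Summits.HodgeConjecture.HodgeCM.Model.Toy.LefPartialConj

/-!
# The Galois closure of a number field in `ℚ̄` and the criterion for partial complex conjugations

Split part 1/2 of `HodgeCM.Model.Toy.LefPartialConjGalois` (its §§1–5, unchanged): the field theory inside `ℚ̄ ⊂ ℂ` that
discharges the hypothesis `PartialConj K₁ K₂` of `LefPartialConj`. §1 `ℚ̄/ℚ` is Galois, `κ` is an involution; §2
`galClosure K ⊆ ℚ̄` (Mathlib's `IntermediateField.normalClosure ℚ K ℚ̄`) and `mem_fixingSubgroup_galClosure_iff` (`γ` fixes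
every embedding of `K` iff it fixes `galClosure K` pointwise); §3 the **criterion** `partialConj_iff`: `PartialConj K₁ K₂ ↔ κ`
fixes `galClosure K₁ ⊓ galClosure K₂` pointwise (the closures meet in a REAL field), via `partialConj_iff_mem_sup` and the
Krull–Galois correspondence of `ℚ̄/ℚ` (`fixingSubgroup_inf_eq_sup`, Mathlib's `InfiniteGalois.fixingSubgroup_fixedField`); §4
consequences (`partialConj_of_inf_eq_bot`, `partialConj_of_odd_finrank`, the obstructions `not_partialConj_of_mem_galClosure`,
`not_partialConj_of_galClosure_le`, `not_partialConj_of_ringHom`); §5 quadratic fields (`partialConj_of_finrank_eq_two`).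
The model headlines and the normal-partner and exclusive-partner criteria are in `HodgeCM.Model.Toy.LefPartialConjGalois`.
Nothing is cited: kernel facts (Mathlib's infinite Galois theory applied to `ℚ̄ = algebraicClosure ℚ ℂ`).
-/

noncomputable section

set_option backward.isDefEq.respectTransparency false

namespace HodgeCM.Toy

open scoped TensorProduct
open exteriorPower Module CMPresentation CMTypeOps
open NumberField.ComplexEmbedding (conjugate)
open Literature.AlgebraicGeometry.Motives

/-! ### 1. `ℚ̄/ℚ` is Galois; complex conjugation `κ` is an involution of `ℚ̄` -/

section Qbar

/-- `ℚ̄ = algebraicClosure ℚ ℂ` is Galois over `ℚ` -/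
instance isGalois_Qbar : IsGalois ℚ Qbar := IsGalois.mk

/-- complex conjugation `κ` on `ℚ̄` is an involution: `κ * κ = 1` in `Aut_ℚ(ℚ̄)` -/
theorem kap_mul_kap : Obj.kap * Obj.kap = 1 := by
  refine AlgEquiv.ext fun x => Subtype.ext ?_
  show ((Obj.kap (Obj.kap x) : Qbar) : ℂ) = (x : ℂ)
  rw [Obj.coe_kap, Obj.coe_kap, starRingEnd_self_apply]

/-- `κ⁻¹ = κ` -/
theorem kap_inv : Obj.kap⁻¹ = Obj.kap :=
  inv_eq_of_mul_eq_one_right kap_mul_kap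

/-- `κ (κ x) = x` -/
theorem kap_kap (x : Qbar) : Obj.kap (Obj.kap x) = x := by
  rw [← AlgEquiv.mul_apply, kap_mul_kap, AlgEquiv.one_apply]

/-- `κ` fixes `x ∈ ℚ̄` iff `x` is real -/
theorem kap_apply_eq_self_iff (x : Qbar) : Obj.kap x = x ↔ starRingEnd ℂ (x : ℂ) = x := by
  rw [← Obj.coe_kap]
  exact ⟨fun h => congrArg Subtype.val h, fun h => Subtype.ext h⟩

end Qbar

/-! ### 2. The Galois closure of a number field inside `ℚ̄`, and what fixing / conjugating all embeddings means -/

section Closure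

variable (K : Type) [Field K] [NumberField K]

/-- the Galois closure of a number field `K`, presented inside `ℚ̄ ⊂ ℂ`: the compositum of all its embeddings -/
def galClosure : IntermediateField ℚ Qbar := IntermediateField.normalClosure ℚ K Qbar

/-- `galClosure K` is the supremum of the images of all `ℚ`-embeddings `K → ℚ̄` (definitional) -/
theorem galClosure_eq : galClosure K = ⨆ f : K →ₐ[ℚ] Qbar, f.fieldRange := rfl

/-- `galClosure K` is normal over `ℚ` -/
instance galClosure_normal : Normal ℚ (galClosure K) := by unfold galClosure; infer_instance

/-- `galClosure K` is finite-dimensional over `ℚ` -/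
instance galClosure_finiteDimensional : FiniteDimensional ℚ (galClosure K) := by
  unfold galClosure; infer_instance

/-- `galClosure K` is Galois over `ℚ` -/
instance galClosure_isGalois : IsGalois ℚ (galClosure K) := IsGalois.mk

/-- the pointwise stabiliser of a Galois closure is a normal subgroup of `Aut_ℚ(ℚ̄)` -/
instance fixingSubgroup_galClosure_normal : (galClosure K).fixingSubgroup.Normal :=
  (InfiniteGalois.normal_iff_isGalois _).mpr inferInstance

/-- the pointwise stabiliser of `galClosure K` is open in the Krull topology of `Aut_ℚ(ℚ̄)` -/
theorem fixingSubgroup_galClosure_isOpen : IsOpen ((galClosure K).fixingSubgroup : Set Gam) :=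
  IntermediateField.fixingSubgroup_isOpen _

/-- a complex embedding as a `ℚ`-algebra map into `ℚ̄` -/
def liftA (a : K →+* ℂ) : K →ₐ[ℚ] Qbar := (liftK a).toRatAlgHom

/-- `liftA K a` agrees with `liftK a` pointwise -/
theorem liftA_apply (a : K →+* ℂ) (y : K) : liftA K a y = liftK a y := rfl

/-- every `ℚ`-algebra map `K → ℚ̄` is the lift `liftA K a` of a complex embedding `a` -/
theorem exists_liftA_eq (f : K →ₐ[ℚ] Qbar) : ∃ a : K →+* ℂ, liftA K a = f :=
  ⟨(algebraMap Qbar ℂ).comp f.toRingHom, AlgHom.ext fun _ => Subtype.ext rfl⟩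

/-- every value of every embedding lies in the Galois closure -/
theorem liftK_mem_galClosure (a : K →+* ℂ) (y : K) : liftK a y ∈ galClosure K :=
  (liftA K a).fieldRange_le_normalClosure ⟨y, rfl⟩

/-- `γ` fixes a compositum `⨆ i, E i` pointwise iff it fixes every `E i` pointwise -/
theorem mem_fixingSubgroup_iSup_iff {ι : Sort*} (E : ι → IntermediateField ℚ Qbar) (γ : Gam) :
    γ ∈ (⨆ i, E i).fixingSubgroup ↔ ∀ i, γ ∈ (E i).fixingSubgroup := by
  simp only [← Subgroup.zpowers_le, ← IntermediateField.le_iff_le, iSup_le_iff]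

/-- `γ` fixes the Galois closure of `K` pointwise iff it fixes every complex embedding of `K` -/
theorem mem_fixingSubgroup_galClosure_iff (γ : Gam) :
    γ ∈ (galClosure K).fixingSubgroup ↔ ∀ a : K →+* ℂ, twist γ a = a := by
  show γ ∈ (⨆ f : K →ₐ[ℚ] Qbar, f.fieldRange).fixingSubgroup ↔ _
  rw [mem_fixingSubgroup_iSup_iff]
  constructor
  · intro h a
    refine RingHom.ext fun x => ?_
    have hx : γ (liftK a x) = liftK a x :=
      (IntermediateField.mem_fixingSubgroup_iff _ _).mp (h (liftA K a)) _ ⟨x, rfl⟩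
    rw [twist_apply, hx, coe_liftK]
  · intro h f
    obtain ⟨a, rfl⟩ := exists_liftA_eq K f
    refine (IntermediateField.mem_fixingSubgroup_iff _ _).mpr ?_
    rintro _ ⟨x, rfl⟩
    apply Subtype.ext
    have := congrArg (fun φ : K →+* ℂ => φ x) (h a)
    rw [twist_apply] at this
    exact this

/-- `γ` is complex conjugation on every embedding of `K` iff `κ⁻¹γ` fixes the Galois closure of `K` pointwise -/
theorem mem_fixingSubgroup_galClosure_iff_conj (γ : Gam) :
    Obj.kap⁻¹ * γ ∈ (galClosure K).fixingSubgroup ↔ ∀ a : K →+* ℂ, twist γ a = conjugate a := by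
  rw [mem_fixingSubgroup_galClosure_iff]
  refine forall_congr' fun a => ?_
  constructor
  · intro h
    have := congrArg (twist Obj.kap) h
    rwa [← twist_mul, ← mul_assoc, mul_inv_cancel, one_mul, twist_kap] at this
  · intro h
    rw [twist_mul, h, ← twist_kap, ← twist_mul, inv_mul_cancel]
    exact twist_one a

/-- `γ` is complex conjugation on the Galois closure of `K` iff it is on every embedding of `K` -/
theorem forall_mem_galClosure_eq_kap_iff (γ : Gam) :
    (∀ x ∈ galClosure K, γ x = Obj.kap x) ↔ ∀ a : K →+* ℂ, twist γ a = conjugate a := by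
  rw [← mem_fixingSubgroup_galClosure_iff_conj, IntermediateField.mem_fixingSubgroup_iff]
  refine forall₂_congr fun x _ => ?_
  rw [kap_inv, AlgEquiv.mul_apply]
  constructor
  · intro h
    rw [h, kap_kap]
  · intro h
    have := congrArg Obj.kap h
    rwa [kap_kap] at this

end Closure

/-! ### 3. The criterion -/

section Criterion

/-- **Krull–Galois bookkeeping**: for intermediate fields `E₁, E₂` of `ℚ̄/ℚ` with `E₁/ℚ` finite, the pointwise
stabiliser of `E₁ ⊓ E₂` is generated by those of `E₁` and `E₂` (the subgroup `H₁ ⊔ H₂` is open, hence closed,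
and its fixed field is `E₁ ⊓ E₂`). -/
theorem fixingSubgroup_inf_eq_sup (E₁ E₂ : IntermediateField ℚ Qbar) [FiniteDimensional ℚ E₁] :
    (E₁ ⊓ E₂).fixingSubgroup = E₁.fixingSubgroup ⊔ E₂.fixingSubgroup := by
  have hopen : IsOpen ((E₁.fixingSubgroup ⊔ E₂.fixingSubgroup : Subgroup Gam) : Set Gam) :=
    Subgroup.isOpen_mono le_sup_left (IntermediateField.fixingSubgroup_isOpen E₁)
  let C : ClosedSubgroup Gam :=
    { toSubgroup := E₁.fixingSubgroup ⊔ E₂.fixingSubgroup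
      isClosed' := Subgroup.isClosed_of_isOpen _ hopen }
  have hfix : IntermediateField.fixedField (E₁.fixingSubgroup ⊔ E₂.fixingSubgroup) = E₁ ⊓ E₂ := by
    refine eq_of_forall_le_iff fun E => ?_
    rw [IntermediateField.le_iff_le, sup_le_iff, ← IntermediateField.le_iff_le, ← IntermediateField.le_iff_le,
      InfiniteGalois.fixedField_fixingSubgroup, InfiniteGalois.fixedField_fixingSubgroup, le_inf_iff]
  have key := InfiniteGalois.fixingSubgroup_fixedField C
  change (IntermediateField.fixedField (E₁.fixingSubgroup ⊔ E₂.fixingSubgroup)).fixingSubgroup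
    = E₁.fixingSubgroup ⊔ E₂.fixingSubgroup at key
  rwa [hfix] at key

variable (K₁ K₂ : Type) [Field K₁] [NumberField K₁] [Field K₂] [NumberField K₂]

open scoped Pointwise in
/-- `PartialConj K₁ K₂` iff complex conjugation lies in the product `H₁H₂` of the pointwise stabilisers of the two
Galois closures -/
theorem partialConj_iff_mem_sup :
    PartialConj K₁ K₂ ↔ Obj.kap ∈ (galClosure K₁).fixingSubgroup ⊔ (galClosure K₂).fixingSubgroup := by
  constructor
  · rintro ⟨γ, h1, h2⟩
    have hγ1 : Obj.kap⁻¹ * γ ∈ (galClosure K₁).fixingSubgroup :=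
      (mem_fixingSubgroup_galClosure_iff_conj K₁ γ).mpr h1
    have hγ2 : γ ∈ (galClosure K₂).fixingSubgroup := (mem_fixingSubgroup_galClosure_iff K₂ γ).mpr h2
    have hk' : Obj.kap = γ * (Obj.kap⁻¹ * γ)⁻¹ := by group
    rw [hk']
    exact Subgroup.mul_mem _ (Subgroup.mem_sup_right hγ2) (Subgroup.mem_sup_left (Subgroup.inv_mem _ hγ1))
  · intro h
    have hmem : Obj.kap ∈
        ((galClosure K₂).fixingSubgroup : Set Gam) * ((galClosure K₁).fixingSubgroup : Set Gam) := by
      rw [← Subgroup.mul_normal, sup_comm]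
      exact h
    obtain ⟨h₂, hh₂, h₁, hh₁, hk⟩ := Set.mem_mul.mp hmem
    refine ⟨h₂, (mem_fixingSubgroup_galClosure_iff_conj K₁ h₂).mp ?_,
      (mem_fixingSubgroup_galClosure_iff K₂ h₂).mp hh₂⟩
    have : Obj.kap⁻¹ * h₂ = h₁⁻¹ := by rw [← hk]; group
    rw [this]
    exact Subgroup.inv_mem _ hh₁

/-- `PartialConj K₁ K₂` iff complex conjugation fixes `galClosure K₁ ⊓ galClosure K₂` pointwise (as a subgroup
membership) -/
theorem partialConj_iff_kap_mem_fixingSubgroup :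
    PartialConj K₁ K₂ ↔ Obj.kap ∈ (galClosure K₁ ⊓ galClosure K₂).fixingSubgroup := by
  rw [partialConj_iff_mem_sup, fixingSubgroup_inf_eq_sup]

/-- **THE CRITERION.** A partial complex conjugation (conjugation on all of `K₁`'s embeddings, identity on all of
`K₂`'s) exists iff complex conjugation fixes the intersection of the two Galois closures pointwise. -/
theorem partialConj_iff :
    PartialConj K₁ K₂ ↔ ∀ x : Qbar, x ∈ galClosure K₁ → x ∈ galClosure K₂ → Obj.kap x = x := by
  rw [partialConj_iff_kap_mem_fixingSubgroup, IntermediateField.mem_fixingSubgroup_iff]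
  simp only [IntermediateField.mem_inf, and_imp]

/-- … iff the two Galois closures meet in a REAL subfield of `ℂ` -/
theorem partialConj_iff_conj_eq :
    PartialConj K₁ K₂ ↔ ∀ x : Qbar, x ∈ galClosure K₁ → x ∈ galClosure K₂ → starRingEnd ℂ (x : ℂ) = x := by
  simp only [partialConj_iff, kap_apply_eq_self_iff]

end Criterion

/-! ### 4. Consequences: sufficient conditions and obstructions -/

section Consequences

variable {K₁ K₂ : Type} [Field K₁] [NumberField K₁] [Field K₂] [NumberField K₂]

/-- **Galois closures meeting in `ℚ` give a partial conjugation.** -/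
theorem partialConj_of_inf_eq_bot (h : galClosure K₁ ⊓ galClosure K₂ = ⊥) : PartialConj K₁ K₂ := by
  rw [partialConj_iff]
  intro x h1 h2
  have hx : x ∈ galClosure K₁ ⊓ galClosure K₂ := IntermediateField.mem_inf.mpr ⟨h1, h2⟩
  rw [h, IntermediateField.mem_bot] at hx
  obtain ⟨q, rfl⟩ := hx
  exact Obj.kap.commutes q

/-- disjoint Galois closures give a partial conjugation (restatement of
`partialConj_of_inf_eq_bot`) -/
theorem partialConj_of_disjoint (h : Disjoint (galClosure K₁) (galClosure K₂)) : PartialConj K₁ K₂ :=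
  partialConj_of_inf_eq_bot (disjoint_iff.mp h)

/-- **Obstruction.** An embedding of `K₂` taking a non-real value inside the Galois closure of `K₁` forbids a
partial conjugation. -/
theorem not_partialConj_of_mem_galClosure (b : K₂ →+* ℂ) (y : K₂) (h : liftK b y ∈ galClosure K₁)
    (hy : starRingEnd ℂ (b y) ≠ b y) : ¬ PartialConj K₁ K₂ := fun hc =>
  hy ((partialConj_iff_conj_eq K₁ K₂).mp hc (liftK b y) h (liftK_mem_galClosure K₂ b y))

/-- in particular `galClosure K₂ ≤ galClosure K₁` is impossible for `K₂` carrying a CM type (e.g. `K₂` the reflex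
field of a primitive CM type on a `D₄` quartic `K₁` — its reflex sister — or a conjugate field of `K₁`) -/
theorem not_partialConj_of_galClosure_le (h : galClosure K₂ ≤ galClosure K₁) (Ψ : CMType K₂) :
    ¬ PartialConj K₁ K₂ := by
  obtain ⟨b⟩ := (inferInstance : Nonempty (K₂ →+* ℂ))
  obtain ⟨y, hy⟩ : ∃ y, conjugate b y ≠ b y := by
    by_contra! h'
    exact conjugate_ne_self_of_cmType Ψ b (RingHom.ext h')
  exact not_partialConj_of_mem_galClosure b y (h (liftK_mem_galClosure K₂ b y)) hy

/-- … nor is `galClosure K₁ ≤ galClosure K₂` for `K₁` carrying a CM type -/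
theorem not_partialConj_of_galClosure_le' (h : galClosure K₁ ≤ galClosure K₂) (Ψ : CMType K₁) :
    ¬ PartialConj K₁ K₂ := fun hc =>
  not_partialConj_of_galClosure_le h Ψ hc.symm

/-- the elementary case of the obstruction: `K₂ ↪ K₁` (no Galois theory needed) -/
theorem not_partialConj_of_ringHom (Ψ : CMType K₂) (e : K₂ →+* K₁) : ¬ PartialConj K₁ K₂ := by
  rintro ⟨γ, h1, h2⟩
  obtain ⟨a⟩ := (inferInstance : Nonempty (K₁ →+* ℂ))
  have h3 : twist γ (a.comp e) = (twist γ a).comp e := RingHom.ext fun _ => rfl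
  have h4 : conjugate (a.comp e) = (conjugate a).comp e := RingHom.ext fun _ => rfl
  have key := h2 (a.comp e)
  rw [h3, h1, ← h4] at key
  exact conjugate_ne_self_of_cmType Ψ (a.comp e) key

/-- and `K₁ ↪ K₂` -/
theorem not_partialConj_of_ringHom' (Ψ : CMType K₁) (e : K₁ →+* K₂) : ¬ PartialConj K₁ K₂ := fun hc =>
  not_partialConj_of_ringHom Ψ e hc.symm

/-- **Galois closures meeting in a field of ODD degree give a partial conjugation** (a Galois extension of `ℚ`
of odd degree is fixed pointwise by the involution `κ`). -/
theorem partialConj_of_odd_finrank (hodd : Odd (Module.finrank ℚ ↥(galClosure K₁ ⊓ galClosure K₂))) :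
    PartialConj K₁ K₂ := by
  haveI : FiniteDimensional ℚ ↥(galClosure K₁ ⊓ galClosure K₂) := Module.finite_of_finrank_pos hodd.pos
  haveI : IsGalois ℚ ↥(galClosure K₁ ⊓ galClosure K₂) := IsGalois.mk
  have h2 : orderOf (Obj.kap.restrictNormal ↥(galClosure K₁ ⊓ galClosure K₂)) ∣ 2 := by
    refine orderOf_dvd_of_pow_eq_one ?_
    show (AlgEquiv.restrictNormalHom ↥(galClosure K₁ ⊓ galClosure K₂) Obj.kap) ^ 2 = 1
    rw [← map_pow, pow_two, kap_mul_kap, map_one]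
  have hc : orderOf (Obj.kap.restrictNormal ↥(galClosure K₁ ⊓ galClosure K₂))
      ∣ Module.finrank ℚ ↥(galClosure K₁ ⊓ galClosure K₂) := by
    rw [← IsGalois.card_aut_eq_finrank]
    exact orderOf_dvd_natCard _
  have h1 : Obj.kap.restrictNormal ↥(galClosure K₁ ⊓ galClosure K₂) = 1 := by
    rw [← orderOf_eq_one_iff]
    rcases (Nat.dvd_prime Nat.prime_two).mp h2 with h | h
    · exact h
    · exfalso
      rw [h] at hc
      exact Nat.not_even_iff_odd.mpr hodd (even_iff_two_dvd.mpr hc)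
  rw [AlgEquiv.restrictNormal_eq_one_iff] at h1
  rw [partialConj_iff]
  exact fun x hx1 hx2 => h1 x (IntermediateField.mem_inf.mpr ⟨hx1, hx2⟩)

end Consequences

/-! ### 5. Quadratic fields: two non-isomorphic quadratic fields always have a partial conjugation -/

section Quadratic

variable (K : Type) [Field K] [NumberField K]

/-- an embedding identifies `K` with its image in `ℚ̄` -/
def equivFieldRange (a : K →+* ℂ) : K ≃ₐ[ℚ] ↥(liftA K a).fieldRange :=
  (AlgEquiv.ofInjectiveField (liftA K a)).trans
    (Subalgebra.equivOfEq _ _ (AlgHom.fieldRange_toSubalgebra (liftA K a)).symm)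

/-- `equivFieldRange K a` is `a`, read in `ℂ` -/
theorem equivFieldRange_apply (a : K →+* ℂ) (y : K) : ((equivFieldRange K a y : Qbar) : ℂ) = a y := rfl

/-- for a NORMAL number field every embedding already fills the Galois closure -/
theorem galClosure_eq_fieldRange [Normal ℚ K] (a : K →+* ℂ) : galClosure K = (liftA K a).fieldRange := by
  haveI : Normal ℚ ↥(liftA K a).fieldRange := Normal.of_algEquiv (equivFieldRange K a)
  refine le_antisymm (normalClosure_le_iff.mpr fun f => ?_) (liftA K a).fieldRange_le_normalClosure
  rintro _ ⟨x, rfl⟩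
  have key := AlgHom.fieldRange_of_normal (f.comp (equivFieldRange K a).symm.toAlgHom)
  have hx : f x ∈ (f.comp (equivFieldRange K a).symm.toAlgHom).fieldRange :=
    ⟨equivFieldRange K a x, by simp⟩
  rwa [key] at hx

/-- the Galois closure of a NORMAL number field `K` has the degree of `K` -/
theorem finrank_galClosure [Normal ℚ K] : Module.finrank ℚ ↥(galClosure K) = Module.finrank ℚ K := by
  obtain ⟨a⟩ := (inferInstance : Nonempty (K →+* ℂ))
  rw [galClosure_eq_fieldRange K a]
  exact (equivFieldRange K a).toLinearEquiv.finrank_eq.symm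

/-- a normal `K` is isomorphic to its Galois closure -/
def equivGalClosure [Normal ℚ K] (a : K →+* ℂ) : K ≃ₐ[ℚ] ↥(galClosure K) :=
  (equivFieldRange K a).trans (IntermediateField.equivOfEq (galClosure_eq_fieldRange K a).symm)

/-- a quadratic number field is normal over `ℚ` -/
theorem normal_of_finrank_eq_two (hK : Module.finrank ℚ K = 2) : Normal ℚ K :=
  haveI : Algebra.IsQuadraticExtension ℚ K := { finrank_eq_two' := hK }
  inferInstance

variable {K}
variable {K₁ K₂ : Type} [Field K₁] [NumberField K₁] [Field K₂] [NumberField K₂]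

/-- the images of two non-isomorphic quadratic fields meet in `ℚ` -/
theorem galClosure_inf_eq_bot_of_finrank_eq_two (h₁ : Module.finrank ℚ K₁ = 2) (h₂ : Module.finrank ℚ K₂ = 2)
    (hne : IsEmpty (K₁ →+* K₂)) : galClosure K₁ ⊓ galClosure K₂ = ⊥ := by
  haveI := normal_of_finrank_eq_two K₁ h₁
  haveI := normal_of_finrank_eq_two K₂ h₂
  obtain ⟨a₁⟩ := (inferInstance : Nonempty (K₁ →+* ℂ))
  obtain ⟨a₂⟩ := (inferInstance : Nonempty (K₂ →+* ℂ))
  have hf₁ : Module.finrank ℚ ↥(galClosure K₁) = 2 := (finrank_galClosure K₁).trans h₁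
  have hf₂ : Module.finrank ℚ ↥(galClosure K₂) = 2 := (finrank_galClosure K₂).trans h₂
  have hd : Module.finrank ℚ ↥(galClosure K₁ ⊓ galClosure K₂) ∣ 2 :=
    hf₁ ▸ IntermediateField.finrank_dvd_of_le_right inf_le_left
  rcases (Nat.dvd_prime Nat.prime_two).mp hd with h | h
  · exact IntermediateField.finrank_eq_one_iff.mp h
  · exfalso
    have e₁ : galClosure K₁ ⊓ galClosure K₂ = galClosure K₁ :=
      IntermediateField.eq_of_le_of_finrank_eq inf_le_left (h.trans hf₁.symm)
    have e₂ : galClosure K₁ ⊓ galClosure K₂ = galClosure K₂ :=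
      IntermediateField.eq_of_le_of_finrank_eq inf_le_right (h.trans hf₂.symm)
    have e : galClosure K₁ = galClosure K₂ := e₁.symm.trans e₂
    exact hne.false (((equivGalClosure K₂ a₂).symm.toRingEquiv.toRingHom.comp
      (IntermediateField.equivOfEq e).toRingEquiv.toRingHom).comp (equivGalClosure K₁ a₁).toRingEquiv.toRingHom)

/-- **two non-isomorphic quadratic fields always have a partial conjugation** (so `LefPartialConj` recovers
`LefQuadMixed`: products of CM elliptic curves with different CM fields) -/
theorem partialConj_of_finrank_eq_two (h₁ : Module.finrank ℚ K₁ = 2) (h₂ : Module.finrank ℚ K₂ = 2)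
    (hne : IsEmpty (K₁ →+* K₂)) : PartialConj K₁ K₂ :=
  partialConj_of_inf_eq_bot (galClosure_inf_eq_bot_of_finrank_eq_two h₁ h₂ hne)

end Quadratic

end HodgeCM.Toy

end
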